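import Literature.AlgebraicGeometry.HodgeTheory.LefschetzOneOneChowProofs
import Literature.AlgebraicGeometry.HodgeTheory.HodgeFiltrationModelsReductionProofs
import Literature.AlgebraicGeometry.HodgeTheory.ComplexifiedDeRhamFamily
import Literature.AlgebraicGeometry.Motives.HodgeDecomposition
import Literature.NumberTheory.Transcendental.DeRhamTheoremProofs
import Literature.NumberTheory.Transcendental.DeRhamTheoremCechProofs
import Literature.Geometry.Kaehler.HolomorphicLineBundleOfPotentials
import Literature.Geometry.Kaehler.PluriharmonicConjugate
import Literature.Geometry.Kaehler.LocalDDbarLemma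
import Literature.Geometry.Kaehler.MayerVietoris
import HarnessLib

/-!
# Lefschetz `(1,1)`, the heart for de Rham's integration comparison, from Čech integrality

Family `hodge`, layer `Literature/AlgebraicGeometry/HodgeTheory`. Proof file (no named facts) for the
named fact `lefschetzOneOne_rational` (`LefschetzOneOne.lean`; Voisin I, §11.3.2: "The case `k = 1` of
[the Hodge conjecture 11.36] holds by theorem 11.30 and corollary 11.34").

The tree reduces `lefschetzOneOne_rational` (`lefschetzOneOne_rational_of_rigidity_of_isTrivialOn`,
`LefschetzOneOneChowProofs`, with rigidity since discharged, `NaturalDeRhamComparisonRigidity_holds`)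
to two inputs: **the heart** `h₁` — for every complex model space `E`, some NATURAL complex de Rham
comparison family satisfies `ComplexDeRhamIsoFamily.IsLefschetzOneOne` (Voisin I, Thm. 11.30 with
Thm. 7.10 (i), in Chern–Weil form: on an analytification of a smooth projective variety, every
integral class in `e(H^{1,1})` is `e[θ]` for the Chern form `θ` of a Hermitian holomorphic line
bundle presented by a cocycle) — and the meromorphic-section lemma `h₂` of the proof of Cor. 11.34.

This file PROVES the heart for de Rham's integration comparison
`e₀ = (integrationDeRhamIsoFamily E) ⊗ ℂ` (natural: `integrationDeRhamIsoFamily_isNatural`,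
`DeRhamIsoFamily.complexify_isNatural`) from ONE purely topological input, stated here as the
explicit hypothesis `hZ` of the theorems (a proof obligation of `lefschetzOneOne_rational`
decomposed in the text, D-0026 — not a separately tracked named fact):

**(Z) Čech integrality.** On a finite chart-convex cover `𝒰` of a compact manifold `M`, let a
closed complex `2`-form `θ` whose class `e₀[θ]` is INTEGRAL be resolved by a zigzag `θ = dα_i` on
`U_i`, `α_i − α_j = df_ij` on `U_i ∩ U_j`, `f_ij + f_jk − f_ik = c_ijk` (constants) on
`U_i ∩ U_j ∩ U_k`; then the Čech `2`-cocycle `c` is cohomologous to an INTEGER cocycle: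
`c_ijk − (a_ij + a_jk − a_ik) ∈ ℤ` on the nonempty triple intersections (Weil 1952; Bott–Tu, Thm. 8.9
with Thm. 15.8 and Prop. 9.5: the Čech–de Rham–singular comparison of an acyclic cover is induced
by integration and respects the integral lattices). It is stated VERBATIM as the hypothesis `hZ` of
the Summits-side companion (route NikulinTwinTransport, item `LefschetzOneOneK3`), so that one
proof of (Z) serves both.

The construction (Weil 1952 / Kostant; Griffiths–Harris pp. 148–149; Voisin I §3.3.1 read
backwards), all steps PROVED from the tree:

1. `exists_real_closed_oneOne_rep` — a REAL closed `(1,1)` representative `θ` of an integral class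
   `β ∈ e₀(H^{1,1})` (`β` is rational hence fixed by conjugation, `IsRationalClass.conjClass_eq`; `e₀`
   is a real family, `DeRhamIsoFamily.complexify_isReal`; so `[θ̄] = [θ]` and `½(θ + θ̄)` works);
2. local potentials `θ = (1/4π) d((dφ_i) ∘ J)` on the sets of a finite chart-convex cover
   (`exists_chartConvexCover`; the local `i∂∂̄`-lemma `exists_potential_of_isOfType_one_one` of
   `Geometry/Kaehler/LocalDDbarLemma`);
3. holomorphic `F_ij` on `U_i ∩ U_j` with `2 Re F_ij = φ_i − φ_j` (pluriharmonic conjugates,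
   `exists_mdifferentiableOn_re_eq_of_pluriharmonic` of `Geometry/Kaehler/PluriharmonicConjugate`), whose
   defects `F_ij + F_jk − F_ik` are imaginary constants (`apply_eq_apply_of_mdifferentiableOn_re_eq_zero`);
4. the de Rham zigzag `α_i = (1/4π)(dφ_i) ∘ J`, `f_ij = −Im F_ij / 2π` (Cauchy–Riemann:
   `d(Im F) = −(d Re F) ∘ J`), `c_ijk` real constants — to which (Z) applies: `c − δa = n ∈ ℤ`,
   `a` real;
5. `G_ij = F_ij + 2πi a_ij` is holomorphic with `2 Re G_ij = φ_i − φ_j` and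
   `G_ij + G_jk − G_ik = −2πi n_ijk`, so `exp G_ij` is a cocycle and `(ofExp, exp φ)` is a Hermitian
   holomorphic line bundle with Chern form `θ` (`HolomorphicLineBundle.exists_isChernForm_of_potentials`
   of `Geometry/Kaehler/HolomorphicLineBundleOfPotentials`).

Results: `exists_isChernForm_of_cechIntegral` (steps 2–5 on a given cover),
`isLefschetzOneOne_complexify_integration_of_cechIntegral` (the heart for `e₀` from (Z)),
`lefschetzOneOne_rational_of_cechIntegral_of_isTrivialOn` (**the named fact from (Z) and the
meromorphic-section lemma `h₂` only**, everything else — rigidity, Chow, universal coefficients,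
local exactness of the Chern form, pull-back calculus — being theorems of the tree).

## References

* C. Voisin, *Hodge Theory and Complex Algebraic Geometry I* (CUP 2002), §3.3.1, Thm. 7.10,
  Thm. 11.30, Cor. 11.34, §11.3.2; Cor. 6.12 (reality of rational classes).
* P. Griffiths, J. Harris, *Principles of Algebraic Geometry* (1978), pp. 148–149, p. 163.
* R. Bott, L. W. Tu, *Differential Forms in Algebraic Topology* (1982), Thm. 8.9, Prop. 9.5,
  Thm. 15.8. * A. Weil, *Sur les théorèmes de de Rham*, Comment. Math. Helv. 26 (1952).
-/

noncomputable section

open scoped Manifold ContDiff Topology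
open Set Filter Function
open Literature.Geometry.Kaehler
open Literature.NumberTheory.Transcendental
open Literature.AlgebraicTopology.SingularHomology (singularCohomology)

namespace Literature.AlgebraicGeometry.HodgeTheory

/-! ### Step 1: a real closed `(1,1)` representative of an integral class of type `(1,1)` -/

section Reality

variable {E : Type} [NormedAddCommGroup E] [NormedSpace ℂ E]
  {M : Type} [TopologicalSpace M] [ChartedSpace E M] [IsManifold 𝓘(ℝ, E) ∞ M]

omit [IsManifold 𝓘(ℝ, E) ∞ M] in
/-- Every class in `H^{p,q}` (the span of the classes of closed `(p,q)`-forms) is the class of ONE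
closed smooth form of type `(p,q)` (closed `(p,q)`-forms form a subspace).
[cite: VoisinHodgeI2002, §2.3.1] -/
theorem exists_isOfType_rep_of_mem_hodgePQ {k p q : ℕ} {c : complexDeRhamCohomology E M k}
    (hc : c ∈ hodgePQ E M k p q) (hpq : p + q = k) :
    ∃ (θ : MForm 𝓘(ℝ, E) M ℂ k) (hθ : θ ∈ cclosedSmoothForms E M k), IsOfType p q θ ∧
      complexDeRhamCohomology.mk E M k ⟨θ, hθ⟩ = c := by
  induction hc using Submodule.span_induction with
  | mem x hx =>
    obtain ⟨α, hα, rfl⟩ := hx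
    exact ⟨α, α.2, hα, rfl⟩
  | zero =>
    exact ⟨0, Submodule.zero_mem _, isOfType_zero hpq, by
      rw [← (complexDeRhamCohomology.mk E M k).map_zero]; rfl⟩
  | add x y _ _ hx hy =>
    obtain ⟨θ₁, h₁, h₁t, rfl⟩ := hx
    obtain ⟨θ₂, h₂, h₂t, rfl⟩ := hy
    exact ⟨θ₁ + θ₂, Submodule.add_mem _ h₁ h₂, h₁t.add h₂t, by rw [← map_add]; rfl⟩
  | smul a x _ hx =>
    obtain ⟨θ₁, h₁, h₁t, rfl⟩ := hx
    exact ⟨a • θ₁, Submodule.smul_mem _ a h₁, h₁t.smul a, by rw [← map_smul]; rfl⟩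

variable [T2Space M] [SigmaCompactSpace M] [FiniteDimensional ℝ E]

/-- **Step 1 — a REAL closed `(1,1)` representative.** If `β ∈ H²(M; ℂ)` is integral and lies in
the image of `H^{1,1}` under de Rham's integration comparison `e₀ = (integrationDeRhamIsoFamily E) ⊗ ℂ`,
then `β = e₀[θ]` for a closed smooth form `θ` of type `(1,1)` which is REAL (`θ̄ = θ`): `β` is
fixed by conjugation (it is rational, `IsRationalClass.conjClass_eq`), `e₀` is a real family
(`DeRhamIsoFamily.complexify_isReal`), so `[θ̄₀] = [θ₀]` and `½(θ₀ + θ̄₀)` is a real closed `(1,1)`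
representative. [cite: VoisinHodgeI2002, §6.1.3 Cor. 6.12 and §7.1.1] -/
theorem exists_real_closed_oneOne_rep (β : singularCohomology ℂ ℂ M 2) (hβ : IsIntegralClass β)
    (h : β ∈ (hodgePQ E M 2 1 1).map
      ((integrationDeRhamIsoFamily E).complexify M 2).toLinearMap) :
    ∃ (θ : MForm 𝓘(ℝ, E) M ℂ 2) (hθ : θ ∈ cclosedSmoothForms E M 2), IsOfType 1 1 θ ∧
      θ.conj = θ ∧
      β = (integrationDeRhamIsoFamily E).complexify M 2
        (complexDeRhamCohomology.mk E M 2 ⟨θ, hθ⟩) := by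
  obtain ⟨c, hc, hcβ⟩ := Submodule.mem_map.1 h
  obtain ⟨θ₀, hθ₀, hθ₀t, rfl⟩ := exists_isOfType_rep_of_mem_hodgePQ hc rfl
  change (integrationDeRhamIsoFamily E).complexify M 2
    (complexDeRhamCohomology.mk E M 2 ⟨θ₀, hθ₀⟩) = β at hcβ
  -- `[θ̄₀] = [θ₀]`: `β` is real and the family is real
  have hreal : ((integrationDeRhamIsoFamily E).complexify).IsReal :=
    DeRhamIsoFamily.complexify_isReal _
  have h1 := hreal.conjClass_apply M 2 (complexDeRhamCohomology.mk E M 2 ⟨θ₀, hθ₀⟩)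
  rw [complexDeRhamCohomology.conj_mk conj_mem_cclosedSmoothForms_holds
    conj_mem_cexactSmoothForms_holds ⟨θ₀, hθ₀⟩, hcβ, hβ.isRationalClass.conjClass_eq] at h1
  have hconj : complexDeRhamCohomology.mk E M 2 ⟨θ₀.conj, conj_mem_cclosedSmoothForms_holds hθ₀⟩ =
      complexDeRhamCohomology.mk E M 2 ⟨θ₀, hθ₀⟩ :=
    ((integrationDeRhamIsoFamily E).complexify M 2).injective (h1.symm.trans hcβ.symm)
  -- the real representative `½(θ₀ + θ̄₀)`
  have hmem : (1 / 2 : ℂ) • (θ₀ + θ₀.conj) ∈ cclosedSmoothForms E M 2 :=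
    Submodule.smul_mem _ _ (Submodule.add_mem _ hθ₀ (conj_mem_cclosedSmoothForms_holds hθ₀))
  refine ⟨(1 / 2 : ℂ) • (θ₀ + θ₀.conj), hmem, (hθ₀t.add hθ₀t.conj).smul _, ?_, ?_⟩
  · have hhalf : (starRingEnd ℂ) (1 / 2 : ℂ) = 1 / 2 := by rw [map_div₀, map_one, map_ofNat]
    rw [MForm.conj_smul, hhalf, MForm.conj_add, MForm.conj_conj, add_comm]
  · rw [← hcβ]
    congr 1
    have hsub : (⟨(1 / 2 : ℂ) • (θ₀ + θ₀.conj), hmem⟩ : cclosedSmoothForms E M 2) =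
        (1 / 2 : ℂ) • ((⟨θ₀, hθ₀⟩ : cclosedSmoothForms E M 2) +
          ⟨θ₀.conj, conj_mem_cclosedSmoothForms_holds hθ₀⟩) := rfl
    rw [hsub, map_smul, map_add, hconj, ← two_smul ℂ, smul_smul]
    norm_num

end Reality

/-! ### Conversions: small Čech sets, chart targets -/

section Conversions

variable {M : Type*}

/-- Single sets of a cover as Čech sets. [folklore] -/
theorem cechSet_const_fin_one {ι : Type*} (U : ι → Set M) (i : ι) :
    Literature.Geometry.Kaehler.cechSet U (fun _ : Fin 1 ↦ i) = U i := by
  ext x; simp [Literature.Geometry.Kaehler.mem_cechSet_iff]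

/-- Double intersections as Čech sets. [folklore] -/
theorem cechSet_vec_two {ι : Type*} (U : ι → Set M) (i j : ι) :
    Literature.Geometry.Kaehler.cechSet U ![i, j] = U i ∩ U j := by
  ext x; simp [Literature.Geometry.Kaehler.mem_cechSet_iff, Fin.forall_fin_two]

/-- Triple intersections as Čech sets. [folklore] -/
theorem cechSet_vec_three {ι : Type*} (U : ι → Set M) (i j k : ι) :
    Literature.Geometry.Kaehler.cechSet U ![i, j, k] = U i ∩ U j ∩ U k := by
  ext x
  simp only [Literature.Geometry.Kaehler.mem_cechSet_iff, Fin.forall_fin_succ, Set.mem_inter_iff]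
  simp [and_assoc]

end Conversions

/-! ### Steps 2–3 on one set: potentials, conjugates, constancy (empty set or chart set) -/

section OneSet

variable {E : Type} [NormedAddCommGroup E] [NormedSpace ℂ E] [FiniteDimensional ℂ E]
  {M : Type} [TopologicalSpace M] [ChartedSpace E M] [IsManifold 𝓘(ℂ, E) ω M]
  [IsManifold 𝓘(ℝ, E) ∞ M] [T2Space M]

/-- The shape of a set of a chart-convex cover: empty, or the chart set of an open convex subset of a
chart target — with the target spelled through `extChartAt` as the bricks want it. [folklore] -/
def IsEmptyOrChartConvex (W : Set M) : Prop :=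
  W = ∅ ∨ ∃ (p : M) (C : Set E), IsOpen C ∧ Convex ℝ C ∧ C ⊆ (extChartAt 𝓘(ℝ, E) p).target ∧
    W = chartSet 𝓘(ℝ, E) p C

omit [FiniteDimensional ℂ E] [IsManifold 𝓘(ℂ, E) ω M] [IsManifold 𝓘(ℝ, E) ∞ M] [T2Space M] in
/-- An empty-or-chart-convex set is open. [folklore] -/
theorem IsEmptyOrChartConvex.isOpen {W : Set M} (hW : IsEmptyOrChartConvex (E := E) W) : IsOpen W := by
  rcases hW with rfl | ⟨p, C, hC, -, -, rfl⟩
  · exact isOpen_empty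
  · exact isOpen_chartSet 𝓘(ℝ, E) p hC

/-- **Step 2 on one set — a local potential.** On an empty-or-chart-convex `W`, a smooth closed real
`(1,1)`-form `θ` is `(1/4π) d((dφ) ∘ J)` for a real `φ`, `C^∞` at the points of `W`
(`exists_potential_of_isOfType_one_one`). [cite: GriffithsHarris1978, p. 149] -/
theorem exists_potential_on {W : Set M} (hW : IsEmptyOrChartConvex (E := E) W)
    {θ : MForm 𝓘(ℝ, E) M ℂ 2} (hs : IsSmoothForm θ) (hc : IsClosedForm θ) (h11 : IsOfType 1 1 θ)
    (hr : θ.conj = θ) :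
    ∃ φ : M → ℝ, (∀ x ∈ W, ContMDiffAt 𝓘(ℝ, E) 𝓘(ℝ, ℝ) ∞ φ x) ∧
      ∀ x ∈ W, ((1 / (4 * Real.pi)) •
        mextDeriv (mextDeriv (MForm.ofFun 𝓘(ℝ, E) fun z ↦ (φ z : ℂ))).compJ) x = θ x := by
  rcases hW with rfl | ⟨p, C, hC, hCc, hCT, rfl⟩
  · exact ⟨fun _ ↦ 0, fun x hx ↦ absurd hx (notMem_empty x), fun x hx ↦ absurd hx (notMem_empty x)⟩
  · have hc' : mextDeriv θ = 0 := hc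
    exact exists_potential_of_isOfType_one_one p hC hCc hCT (fun x _ ↦ hs x)
      (fun x _ ↦ by rw [hc']; rfl) h11 (fun x _ ↦ by rw [hr])

omit [T2Space M] in
/-- **Step 3 on one set — a pluriharmonic conjugate.** On an empty-or-chart-convex `W`, a real `u`,
`C^∞` at the points of `W` with `d((du) ∘ J) = 0` there, is `Re F` for an `F` holomorphic on `W`
(`exists_mdifferentiableOn_re_eq_of_pluriharmonic`). [cite: GriffithsHarris1978, pp. 148–149] -/
theorem exists_conjugate_on {W : Set M} (hW : IsEmptyOrChartConvex (E := E) W) {u : M → ℝ}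
    (hu : ∀ x ∈ W, ContMDiffAt 𝓘(ℝ, E) 𝓘(ℝ, ℝ) ∞ u x)
    (hdd : ∀ x ∈ W, mextDeriv (mextDeriv (MForm.ofFun 𝓘(ℝ, E) fun z ↦ (u z : ℂ))).compJ x = 0) :
    ∃ F : M → ℂ, MDifferentiableOn 𝓘(ℂ, E) 𝓘(ℂ, ℂ) F W ∧ ∀ x ∈ W, (F x).re = u x := by
  rcases hW with rfl | ⟨p, C, hC, hCc, hCT, rfl⟩
  · exact ⟨fun _ ↦ 0, fun x hx ↦ absurd hx (notMem_empty x), fun x hx ↦ absurd hx (notMem_empty x)⟩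
  · exact exists_mdifferentiableOn_re_eq_of_pluriharmonic p hC hCc hCT hu hdd

omit [FiniteDimensional ℂ E] [IsManifold 𝓘(ℝ, E) ∞ M] [T2Space M] in
/-- **Constancy on one set.** On an empty-or-chart-convex `W`, a holomorphic function with vanishing
real part is constant: there is `c` with `F = c` on `W` (`apply_eq_apply_of_mdifferentiableOn_re_eq_zero`).
[cite: GriffithsHarris1978, p. 149] -/
theorem exists_const_on {W : Set M} (hW : IsEmptyOrChartConvex (E := E) W) {F : M → ℂ}
    (hF : MDifferentiableOn 𝓘(ℂ, E) 𝓘(ℂ, ℂ) F W) (hre : ∀ x ∈ W, (F x).re = 0) :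
    ∃ c : ℂ, ∀ x ∈ W, F x = c := by
  rcases hW with rfl | ⟨p, C, hC, hCc, hCT, rfl⟩
  · exact ⟨0, fun x hx ↦ absurd hx (notMem_empty x)⟩
  · rcases (chartSet 𝓘(ℝ, E) p C).eq_empty_or_nonempty with h0 | ⟨x₀, hx₀⟩
    · exact ⟨0, fun x hx ↦ by rw [h0] at hx; exact absurd hx (notMem_empty x)⟩
    · exact ⟨F x₀, fun x hx ↦
        apply_eq_apply_of_mdifferentiableOn_re_eq_zero p hC hCc hCT hF hre hx hx₀⟩

/-! ### Cauchy–Riemann for the zigzag: `d(Im F) = −(d Re F) ∘ J` for holomorphic `F` -/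

omit [T2Space M] in
/-- **`d(Im F)(v) = −d(Re F)(Jv)` for `F` holomorphic on an open set** (the differential of `F` is
`ℂ`-linear in the chart at the point). [cite: VoisinHodgeI2002, Lemma 2.29] -/
theorem mextDeriv_ofFun_im_eq_neg_re_compJ {F : M → ℂ} {V : Set M}
    (hF : MDifferentiableOn 𝓘(ℂ, E) 𝓘(ℂ, ℂ) F V) (hV : IsOpen V) {x : M} (hx : x ∈ V)
    (v : Fin 1 → TangentSpace 𝓘(ℝ, E) x) :
    mextDeriv (MForm.ofFun 𝓘(ℝ, E) fun z ↦ ((F z).im : ℂ)) x v =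
      -mextDeriv (MForm.ofFun 𝓘(ℝ, E) fun z ↦ ((F z).re : ℂ)) x (fun i ↦ tangentJ E x (v i)) := by
  have hFs : ContMDiffAt 𝓘(ℝ, E) 𝓘(ℝ, ℂ) ∞ F x :=
    contMDiffAt_real_of_mdifferentiableOn_complex hF hV hx
  rw [mextDeriv_ofFun_im_apply hFs, mextDeriv_ofFun_re_apply hFs, mextDeriv_ofFun_apply,
    mextDeriv_ofFun_apply]
  simp only [ModelWithCorners.Boundaryless.range_eq_univ, fderivWithin_univ, tangentJ_apply]
  have hd : DifferentiableAt ℂ (F ∘ (extChartAt 𝓘(ℝ, E) x).symm) (extChartAt 𝓘(ℝ, E) x x) :=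
    differentiableAt_comp_extChartAt_symm_of_mdifferentiableAt
      ((hF x hx).mdifferentiableAt (hV.mem_nhds hx))
  rw [hd.fderiv_restrictScalars ℝ, ContinuousLinearMap.coe_restrictScalars',
    (fderiv ℂ (F ∘ (extChartAt 𝓘(ℝ, E) x).symm) (extChartAt 𝓘(ℝ, E) x x)).map_smul,
    smul_eq_mul, Complex.I_mul_re]
  push_cast
  ring

end OneSet

/-! ### Steps 2–5 on a chart-convex cover: the Hermitian holomorphic line bundle with Chern form `θ` -/

section Core

variable {E : Type} [NormedAddCommGroup E] [NormedSpace ℂ E] [FiniteDimensional ℂ E]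
  {M : Type} [TopologicalSpace M] [ChartedSpace E M] [IsManifold 𝓘(ℂ, E) ω M]
  [IsManifold 𝓘(ℝ, E) ∞ M] [T2Space M]

/-- **The heart on a given chart-convex cover, from Čech integrality for the form at hand.** Let
`𝒰` be a chart-convex cover of the complex manifold `M` and `θ` a smooth closed REAL `(1,1)`-form.
Suppose (hypothesis `hZθ`, the instance of (Z) for `θ` and `𝒰`) that for every de Rham zigzag
`θ = dα_i`, `α_i − α_j = df_ij`, `f_ij + f_jk − f_ik = c_ijk` on `𝒰` the Čech cocycle `c` is
cohomologous to an integer cocycle. Then `θ` is the Chern form of a Hermitian holomorphic line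
bundle presented by a cocycle on the cover (steps 2–5 of the module docstring).
[cite: GriffithsHarris1978, pp. 148–149] [cite: VoisinHodgeI2002, §3.3.1 and Thm. 7.10] -/
theorem exists_isChernForm_of_cechIntegral {ι : Type} (𝒰 : ChartConvexCover E M ι)
    {θ : MForm 𝓘(ℝ, E) M ℂ 2} (hs : IsSmoothForm θ) (hc : IsClosedForm θ) (h11 : IsOfType 1 1 θ)
    (hr : θ.conj = θ)
    (hZθ : ∀ (α : ι → MForm 𝓘(ℝ, E) M ℂ 1), (∀ i, α i ∈ smoothFormsOn 𝓘(ℝ, E) ℂ (𝒰.U i) 1) →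
        (∀ i, ∀ x ∈ 𝒰.U i, mextDeriv (α i) x = θ x) →
      ∀ (f : ι → ι → M → ℂ),
        (∀ i j, ∀ x ∈ 𝒰.U i ∩ 𝒰.U j, (MForm.ofFun 𝓘(ℝ, E) (f i j)).SmoothAt x) →
        (∀ i j, ∀ x ∈ 𝒰.U i ∩ 𝒰.U j,
          mextDeriv (MForm.ofFun 𝓘(ℝ, E) (f i j)) x = α i x - α j x) →
      ∀ (c : ι → ι → ι → ℂ),
        (∀ i j k, ∀ x ∈ 𝒰.U i ∩ 𝒰.U j ∩ 𝒰.U k, f i j x + f j k x - f i k x = c i j k) →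
      ∃ (a : ι → ι → ℂ) (n : ι → ι → ι → ℤ), ∀ i j k, (𝒰.U i ∩ 𝒰.U j ∩ 𝒰.U k).Nonempty →
        c i j k - (a i j + a j k - a i k) = n i j k) :
    ∃ (L : HolomorphicLineBundle ι E M) (h : L.HermitianMetric), L.baseSet = 𝒰.U ∧ h.IsChernForm θ := by
  -- the sets of the cover and their small intersections are empty or chart-convex
  have hdesc : ∀ {m : ℕ} (J : Fin (m + 1) → ι),
      IsEmptyOrChartConvex (E := E) (Literature.Geometry.Kaehler.cechSet 𝒰.U J) := by
    intro m J
    rcases (Literature.Geometry.Kaehler.cechSet 𝒰.U J).eq_empty_or_nonempty with h | h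
    · exact Or.inl h
    · obtain ⟨p, C, hC, hCc, hCt, hJ⟩ := 𝒰.exists_chart m J h
      refine Or.inr ⟨p, C, hC, hCc, ?_, hJ⟩
      rw [extChartAt_self]
      exact hCt
  have hU1 : ∀ i, IsEmptyOrChartConvex (E := E) (𝒰.U i) := fun i ↦ by
    simpa only [cechSet_const_fin_one] using hdesc (fun _ : Fin 1 ↦ i)
  have hU2 : ∀ i j, IsEmptyOrChartConvex (E := E) (𝒰.U i ∩ 𝒰.U j) := fun i j ↦ by
    simpa only [cechSet_vec_two] using hdesc ![i, j]
  have hU3 : ∀ i j k, IsEmptyOrChartConvex (E := E) (𝒰.U i ∩ 𝒰.U j ∩ 𝒰.U k) := fun i j k ↦ by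
    simpa only [cechSet_vec_three] using hdesc ![i, j, k]
  have hUo : ∀ i, IsOpen (𝒰.U i) := 𝒰.isOpen
  have hUo2 : ∀ i j, IsOpen (𝒰.U i ∩ 𝒰.U j) := fun i j ↦ (hUo i).inter (hUo j)
  have hUo3 : ∀ i j k, IsOpen (𝒰.U i ∩ 𝒰.U j ∩ 𝒰.U k) := fun i j k ↦ (hUo2 i j).inter (hUo k)
  ---- Step 2: local potentials `θ = (1/4π) d((dφ_i) ∘ J)` on `U_i`
  choose φ hφs hφ using fun i ↦ exists_potential_on (hU1 i) hs hc h11 hr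
  -- the complexified potentials as `0`-forms, their smoothness near the points of `U_i`
  set φC : ι → M → ℂ := fun i z ↦ (φ i z : ℂ) with hφC_def
  have hφCs : ∀ i, ∀ x ∈ 𝒰.U i, ContMDiffAt 𝓘(ℝ, E) 𝓘(ℝ, ℂ) ∞ (φC i) x := fun i x hx ↦
    Complex.ofRealCLM.contDiff.comp_contMDiffAt (hφs i x hx)
  have hφ0 : ∀ i, ∀ x ∈ 𝒰.U i, ∀ᶠ z in 𝓝 x, (MForm.ofFun 𝓘(ℝ, E) (φC i)).SmoothAt z :=
    fun i x hx ↦ Filter.eventually_of_mem ((hUo i).mem_nhds hx) fun z hz ↦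
      MForm.smoothAt_ofFun_of_contMDiffAt (hφCs i z hz)
  ---- Step 3: holomorphic `F_ij` with `2 Re F_ij = φ_i − φ_j` on `U_i ∩ U_j`
  have hu : ∀ i j, ∀ x ∈ 𝒰.U i ∩ 𝒰.U j,
      ContMDiffAt 𝓘(ℝ, E) 𝓘(ℝ, ℝ) ∞ (fun z ↦ (φ i z - φ j z) / 2) x := fun i j x hx ↦
    ((hφs i x hx.1).sub (hφs j x hx.2)).div_const 2
  have hudd : ∀ i j, ∀ x ∈ 𝒰.U i ∩ 𝒰.U j,
      mextDeriv (mextDeriv (MForm.ofFun 𝓘(ℝ, E) fun z ↦ (((φ i z - φ j z) / 2 : ℝ) : ℂ))).compJ x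
        = 0 := by
    intro i j x hx
    -- `(φ_i − φ_j)/2` as the combination `½ φ_iC − ½ φ_jC` of `0`-forms
    have hform : (MForm.ofFun 𝓘(ℝ, E) fun z ↦ (((φ i z - φ j z) / 2 : ℝ) : ℂ)) =
        (1 / 2 : ℝ) • (MForm.ofFun 𝓘(ℝ, E) (φC i) + (-1 : ℝ) • MForm.ofFun 𝓘(ℝ, E) (φC j)) := by
      funext z
      ext v
      simp only [MForm.ofFun_apply, hφC_def, Pi.smul_apply, Pi.add_apply,
        ContinuousAlternatingMap.smul_apply, ContinuousAlternatingMap.add_apply, Complex.real_smul]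
      push_cast
      ring
    rw [hform, mextDeriv_smul, MForm.compJ_smul, mextDeriv_smul, Pi.smul_apply]
    -- `d` of the sum at `x`: both summands are smooth near `x`
    have h1 : ∀ᶠ z in 𝓝 x, (MForm.ofFun 𝓘(ℝ, E) (φC i)).SmoothAt z := hφ0 i x hx.1
    have h2 : ∀ᶠ z in 𝓝 x, ((-1 : ℝ) • MForm.ofFun 𝓘(ℝ, E) (φC j)).SmoothAt z :=
      (hφ0 j x hx.2).mono fun z hz ↦ hz.smul _
    have hsum : ∀ᶠ z in 𝓝 x,
        mextDeriv (MForm.ofFun 𝓘(ℝ, E) (φC i) + (-1 : ℝ) • MForm.ofFun 𝓘(ℝ, E) (φC j)) z =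
          (mextDeriv (MForm.ofFun 𝓘(ℝ, E) (φC i)) +
            (-1 : ℝ) • mextDeriv (MForm.ofFun 𝓘(ℝ, E) (φC j))) z := by
      filter_upwards [h1.eventually_nhds, h2.eventually_nhds] with z hz1 hz2
      rw [mextDeriv_add_apply hz1.self_of_nhds hz2.self_of_nhds, mextDeriv_smul, Pi.add_apply,
        Pi.smul_apply]
    have hsumJ : ∀ᶠ z in 𝓝 x,
        (mextDeriv (MForm.ofFun 𝓘(ℝ, E) (φC i) + (-1 : ℝ) • MForm.ofFun 𝓘(ℝ, E) (φC j))).compJ z =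
          ((mextDeriv (MForm.ofFun 𝓘(ℝ, E) (φC i))).compJ +
            (-1 : ℝ) • (mextDeriv (MForm.ofFun 𝓘(ℝ, E) (φC j))).compJ) z := by
      filter_upwards [hsum] with z hz
      ext v
      rw [MForm.compJ_apply, hz]
      simp only [Pi.add_apply, Pi.smul_apply, ContinuousAlternatingMap.add_apply,
        ContinuousAlternatingMap.smul_apply, MForm.compJ_apply]
    have hd1 : ((mextDeriv (MForm.ofFun 𝓘(ℝ, E) (φC i))).compJ).SmoothAt x :=
      (MForm.SmoothAt.mextDeriv h1).compJ
    have hd2 : ((-1 : ℝ) • (mextDeriv (MForm.ofFun 𝓘(ℝ, E) (φC j))).compJ).SmoothAt x :=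
      ((MForm.SmoothAt.mextDeriv (hφ0 j x hx.2)).compJ).smul _
    rw [mextDeriv_congr_of_eventuallyEq hsumJ, mextDeriv_add_apply hd1 hd2, mextDeriv_smul,
      Pi.smul_apply]
    -- both `d((dφ) ∘ J)` are `4π θ x`
    have key : ∀ l, x ∈ 𝒰.U l →
        mextDeriv (mextDeriv (MForm.ofFun 𝓘(ℝ, E) (φC l))).compJ x = (4 * Real.pi) • θ x := by
      intro l hl
      have h := hφ l x hl
      rw [Pi.smul_apply] at h
      rw [← h, smul_smul, show (4 * Real.pi) * (1 / (4 * Real.pi)) = 1 by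
        field_simp, one_smul]
    rw [key i hx.1, key j hx.2]
    simp
  choose F hF hFre using fun i j ↦ exists_conjugate_on (hU2 i j) (hu i j) (hudd i j)
  have hFre2 : ∀ i j, ∀ x ∈ 𝒰.U i ∩ 𝒰.U j, 2 * (F i j x).re = φ i x - φ j x := by
    intro i j x hx
    rw [hFre i j x hx]
    ring
  have hFs : ∀ i j, ∀ x ∈ 𝒰.U i ∩ 𝒰.U j, ContMDiffAt 𝓘(ℝ, E) 𝓘(ℝ, ℂ) ∞ (F i j) x :=
    fun i j x hx ↦ contMDiffAt_real_of_mdifferentiableOn_complex (hF i j) (hUo2 i j) hx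
  -- the defects are constant on the triple intersections
  have hdefect : ∀ i j k, ∃ cc : ℂ, ∀ x ∈ 𝒰.U i ∩ 𝒰.U j ∩ 𝒰.U k,
      F i j x + F j k x - F i k x = cc := by
    intro i j k
    have hs1 : 𝒰.U i ∩ 𝒰.U j ∩ 𝒰.U k ⊆ 𝒰.U i ∩ 𝒰.U j := fun y hy ↦ ⟨hy.1.1, hy.1.2⟩
    have hs2 : 𝒰.U i ∩ 𝒰.U j ∩ 𝒰.U k ⊆ 𝒰.U j ∩ 𝒰.U k := fun y hy ↦ ⟨hy.1.2, hy.2⟩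
    have hs3 : 𝒰.U i ∩ 𝒰.U j ∩ 𝒰.U k ⊆ 𝒰.U i ∩ 𝒰.U k := fun y hy ↦ ⟨hy.1.1, hy.2⟩
    refine exists_const_on (hU3 i j k) (F := fun y ↦ F i j y + F j k y - F i k y) ?_ ?_
    · intro x hx
      exact (((hF i j).mono hs1 x hx).add ((hF j k).mono hs2 x hx)).sub ((hF i k).mono hs3 x hx)
    · intro x hx
      simp only [Complex.sub_re, Complex.add_re, hFre i j x ⟨hx.1.1, hx.1.2⟩,
        hFre j k x ⟨hx.1.2, hx.2⟩, hFre i k x ⟨hx.1.1, hx.2⟩]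
      ring
  choose cc hcc using hdefect
  ---- Step 4: the de Rham zigzag `α_i = (1/4π)(dφ_i) ∘ J`, `f_ij = −Im F_ij / 2π`, `c` real
  set α : ι → MForm 𝓘(ℝ, E) M ℂ 1 := fun i ↦
    ((1 / (4 * Real.pi)) • (mextDeriv (MForm.ofFun 𝓘(ℝ, E) (φC i))).compJ).restr (𝒰.U i)
    with hα_def
  have hαmem : ∀ i, α i ∈ smoothFormsOn 𝓘(ℝ, E) ℂ (𝒰.U i) 1 := fun i ↦
    ⟨fun x hx ↦ (MForm.smoothAt_restr_iff (hUo i) _ hx).2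
      ((MForm.SmoothAt.mextDeriv (hφ0 i x hx)).compJ.smul _),
      fun x hx ↦ MForm.restr_apply_of_notMem _ hx⟩
  have hdα : ∀ i, ∀ x ∈ 𝒰.U i, mextDeriv (α i) x = θ x := by
    intro i x hx
    rw [hα_def, mextDeriv_restr_apply (hUo i) _ hx, mextDeriv_smul]
    exact hφ i x hx
  set f : ι → ι → M → ℂ := fun i j z ↦ ((-(1 / (2 * Real.pi)) * (F i j z).im : ℝ) : ℂ)
    with hf_def
  have hfform : ∀ i j, MForm.ofFun 𝓘(ℝ, E) (f i j) =
      (-(1 / (2 * Real.pi))) • MForm.ofFun 𝓘(ℝ, E) (fun z ↦ (((F i j z).im : ℝ) : ℂ)) := by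
    intro i j
    funext z
    ext v
    simp only [MForm.ofFun_apply, hf_def, Pi.smul_apply, ContinuousAlternatingMap.smul_apply,
      Complex.real_smul]
    push_cast
    ring
  have hfs : ∀ i j, ∀ x ∈ 𝒰.U i ∩ 𝒰.U j, (MForm.ofFun 𝓘(ℝ, E) (f i j)).SmoothAt x := by
    intro i j x hx
    rw [hfform]
    exact (MForm.smoothAt_ofFun_of_contMDiffAt
      ((Complex.ofRealCLM.comp Complex.imCLM).contDiff.comp_contMDiffAt (hFs i j x hx))).smul _
  have hdf : ∀ i j, ∀ x ∈ 𝒰.U i ∩ 𝒰.U j,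
      mextDeriv (MForm.ofFun 𝓘(ℝ, E) (f i j)) x = α i x - α j x := by
    intro i j x hx
    -- `d(φ_i − φ_j) = 2 d(Re F_ij)` near `x`
    have hReform : ∀ᶠ z in 𝓝 x, (MForm.ofFun 𝓘(ℝ, E) (φC i) + (-1 : ℝ) • MForm.ofFun 𝓘(ℝ, E) (φC j)) z =
        ((2 : ℝ) • MForm.ofFun 𝓘(ℝ, E) (fun z ↦ (((F i j z).re : ℝ) : ℂ))) z := by
      filter_upwards [(hUo2 i j).mem_nhds hx] with z hz
      ext v
      simp only [Pi.add_apply, Pi.smul_apply, ContinuousAlternatingMap.add_apply,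
        ContinuousAlternatingMap.smul_apply, MForm.ofFun_apply, hφC_def, Complex.real_smul]
      have h := hFre2 i j z hz
      push_cast
      rw [show (2 : ℂ) * ((F i j z).re : ℂ) = ((2 * (F i j z).re : ℝ) : ℂ) by push_cast; ring, h]
      push_cast
      ring
    have h1 : ∀ᶠ z in 𝓝 x, (MForm.ofFun 𝓘(ℝ, E) (φC i)).SmoothAt z := hφ0 i x hx.1
    have h2 : ∀ᶠ z in 𝓝 x, ((-1 : ℝ) • MForm.ofFun 𝓘(ℝ, E) (φC j)).SmoothAt z :=
      (hφ0 j x hx.2).mono fun z hz ↦ hz.smul _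
    have hdd : mextDeriv (MForm.ofFun 𝓘(ℝ, E) (φC i)) x - mextDeriv (MForm.ofFun 𝓘(ℝ, E) (φC j)) x =
        (2 : ℝ) • mextDeriv (MForm.ofFun 𝓘(ℝ, E) (fun z ↦ (((F i j z).re : ℝ) : ℂ))) x := by
      have h := mextDeriv_congr_of_eventuallyEq hReform
      rw [mextDeriv_add_apply h1.self_of_nhds h2.self_of_nhds, mextDeriv_smul, mextDeriv_smul,
        Pi.smul_apply, Pi.smul_apply, neg_one_smul, ← sub_eq_add_neg] at h
      exact h
    ext v
    have hαi : α i x = ((1 / (4 * Real.pi)) • (mextDeriv (MForm.ofFun 𝓘(ℝ, E) (φC i))).compJ) x := by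
      simp only [hα_def, MForm.restr_apply_of_mem _ hx.1]
    have hαj : α j x = ((1 / (4 * Real.pi)) • (mextDeriv (MForm.ofFun 𝓘(ℝ, E) (φC j))).compJ) x := by
      simp only [hα_def, MForm.restr_apply_of_mem _ hx.2]
    have hddv := DFunLike.congr_fun hdd (fun l ↦ tangentJ E x (v l))
    simp only [ContinuousAlternatingMap.sub_apply, ContinuousAlternatingMap.smul_apply,
      Complex.real_smul] at hddv
    rw [ContinuousAlternatingMap.sub_apply, hαi, hαj, hfform, mextDeriv_smul, Pi.smul_apply,
      ContinuousAlternatingMap.smul_apply, mextDeriv_ofFun_im_eq_neg_re_compJ (hF i j) (hUo2 i j) hx]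
    simp only [Pi.smul_apply, ContinuousAlternatingMap.smul_apply, MForm.compJ_apply,
      Complex.real_smul]
    push_cast at hddv ⊢
    linear_combination (-(1 / (4 * (Real.pi : ℂ)))) * hddv
  set c : ι → ι → ι → ℂ := fun i j k ↦ ((-(1 / (2 * Real.pi)) * (cc i j k).im : ℝ) : ℂ)
    with hc_def
  have hcrel : ∀ i j k, ∀ x ∈ 𝒰.U i ∩ 𝒰.U j ∩ 𝒰.U k, f i j x + f j k x - f i k x = c i j k := by
    intro i j k x hx
    have h := congrArg Complex.im (hcc i j k x hx)
    simp only [Complex.sub_im, Complex.add_im] at h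
    simp only [hf_def, hc_def, ← h]
    push_cast
    ring
  ---- (Z): `c − δa = n ∈ ℤ`
  obtain ⟨a, n, han⟩ := hZθ α hαmem hdα f hfs hdf c hcrel
  -- real parts: `c` is real, so `c − δ(Re a) = n` as well
  have hanr : ∀ i j k, (𝒰.U i ∩ 𝒰.U j ∩ 𝒰.U k).Nonempty →
      (c i j k).re - ((a i j).re + (a j k).re - (a i k).re) = n i j k := by
    intro i j k hne
    have h := congrArg Complex.re (han i j k hne)
    simpa only [Complex.sub_re, Complex.add_re, Complex.intCast_re] using h
  have hcre : ∀ i j k, (c i j k).re = -(1 / (2 * Real.pi)) * (cc i j k).im := by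
    intro i j k
    simp only [hc_def, Complex.ofReal_re]
  -- the defects `cc` are imaginary: `Re cc = 0` on nonempty triples
  have hccre : ∀ i j k, ∀ x ∈ 𝒰.U i ∩ 𝒰.U j ∩ 𝒰.U k, (cc i j k).re = 0 := by
    intro i j k x hx
    have h := congrArg Complex.re (hcc i j k x hx)
    simp only [Complex.sub_re, Complex.add_re, hFre i j x ⟨hx.1.1, hx.1.2⟩,
      hFre j k x ⟨hx.1.2, hx.2⟩, hFre i k x ⟨hx.1.1, hx.2⟩] at h
    linarith
  ---- Step 5: the holomorphic cocycle `G_ij = F_ij + 2πi Re(a_ij)` and the packaging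
  set G : ι → ι → M → ℂ := fun i j z ↦ F i j z + 2 * Real.pi * Complex.I * ((a i j).re : ℂ)
    with hG_def
  have hG : ∀ i j, MDifferentiableOn 𝓘(ℂ, E) 𝓘(ℂ, ℂ) (G i j) (𝒰.U i ∩ 𝒰.U j) := fun i j x hx ↦
    (hF i j x hx).add mdifferentiableWithinAt_const
  have hGre : ∀ i j, ∀ x ∈ 𝒰.U i ∩ 𝒰.U j, 2 * (G i j x).re = φ i x - φ j x := by
    intro i j x hx
    rw [← hFre2 i j x hx, hG_def]
    simp
  have hGcoc : ∀ i j k, ∀ x ∈ 𝒰.U i ∩ 𝒰.U j ∩ 𝒰.U k,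
      ∃ m : ℤ, G i j x + G j k x - G i k x = m * (2 * Real.pi * Complex.I) := by
    intro i j k x hx
    refine ⟨-n i j k, ?_⟩
    have h1 := hcc i j k x hx
    have h2 := hanr i j k ⟨x, hx⟩
    have h3 := hccre i j k x hx
    -- `cc = i Im cc` and `c.re − δ(Re a) = n`, `c.re = −Im cc / 2π`
    have hccI : cc i j k = ((cc i j k).im : ℂ) * Complex.I := by
      apply Complex.ext <;> simp [h3]
    have hsum : G i j x + G j k x - G i k x =
        cc i j k + 2 * Real.pi * Complex.I * (((a i j).re + (a j k).re - (a i k).re : ℝ) : ℂ) := by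
      simp only [hG_def, ← h1]
      push_cast
      ring
    rw [hsum, hccI]
    have h4 : ((a i j).re + (a j k).re - (a i k).re : ℝ) = (c i j k).re - n i j k := by linarith
    rw [h4, hcre]
    have hπ : (Real.pi : ℂ) ≠ 0 := Complex.ofReal_ne_zero.2 Real.pi_ne_zero
    push_cast
    field_simp
    ring
  obtain ⟨L, h, hLU, hChern⟩ := HolomorphicLineBundle.exists_isChernForm_of_potentials 𝒰.U hUo
    (fun x ↦ by
      have hx : x ∈ ⋃ i, 𝒰.U i := by rw [𝒰.iUnion_eq]; exact mem_univ x
      exact mem_iUnion.1 hx)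
    φ (fun i x hx ↦ (hφs i x hx).contMDiffWithinAt) G hG hGre
    (HolomorphicLineBundle.exp_mul_exp_eq_exp_of_exists_int hGcoc)
    (θ := θ) (fun i x hx ↦ (hφ i x hx).symm)
  exact ⟨L, h, hLU, hChern⟩

end Core

/-! ### The heart for `e₀ = integration ⊗ ℂ`, and the named fact, from (Z) -/

section Heart

/-- **The heart of Lefschetz `(1,1)` for de Rham's integration comparison, from Čech integrality
(Z).** For every finite-dimensional complex model space `E`, the complexified integration family
`(integrationDeRhamIsoFamily E) ⊗ ℂ` satisfies `ComplexDeRhamIsoFamily.IsLefschetzOneOne`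
(Voisin I, Thm. 11.30 with Thm. 7.10 (i) in Chern–Weil form): on an analytification `M` of a smooth
projective `X/ℂ` (compact), an integral class `β ∈ e₀(H^{1,1})` has a real closed `(1,1)`
representative `θ` (Step 1), and on a finite chart-convex cover of `M` (`exists_chartConvexCover`)
`θ` is the Chern form of a Hermitian holomorphic cocycle line bundle by
`exists_isChernForm_of_cechIntegral`, (Z) being the hypothesis `hZ` (stated verbatim as in the
Summits-side companion of route NikulinTwinTransport). [cite: VoisinHodgeI2002, Thm. 11.30 and Thm. 7.10 (i)]
[cite: GriffithsHarris1978, p. 163] -/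
theorem isLefschetzOneOne_complexify_integration_of_cechIntegral
    (hZ : ∀ (E : Type) [NormedAddCommGroup E] [NormedSpace ℂ E] [FiniteDimensional ℝ E]
      (M : Type) [TopologicalSpace M] [ChartedSpace E M] [IsManifold 𝓘(ℝ, E) ∞ M] [T2Space M]
      [CompactSpace M] (ι : Type) [Fintype ι] (𝒰 : ChartConvexCover E M ι)
      (θ : MForm 𝓘(ℝ, E) M ℂ 2) (hθ : θ ∈ cclosedSmoothForms E M 2),
      IsIntegralClass ((integrationDeRhamIsoFamily E).complexify M 2
        (complexDeRhamCohomology.mk E M 2 ⟨θ, hθ⟩)) →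
      ∀ (α : ι → MForm 𝓘(ℝ, E) M ℂ 1), (∀ i, α i ∈ smoothFormsOn 𝓘(ℝ, E) ℂ (𝒰.U i) 1) →
        (∀ i, ∀ x ∈ 𝒰.U i, mextDeriv (α i) x = θ x) →
      ∀ (f : ι → ι → M → ℂ),
        (∀ i j, ∀ x ∈ 𝒰.U i ∩ 𝒰.U j, (MForm.ofFun 𝓘(ℝ, E) (f i j)).SmoothAt x) →
        (∀ i j, ∀ x ∈ 𝒰.U i ∩ 𝒰.U j,
          mextDeriv (MForm.ofFun 𝓘(ℝ, E) (f i j)) x = α i x - α j x) →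
      ∀ (c : ι → ι → ι → ℂ),
        (∀ i j k, ∀ x ∈ 𝒰.U i ∩ 𝒰.U j ∩ 𝒰.U k, f i j x + f j k x - f i k x = c i j k) →
      ∃ (a : ι → ι → ℂ) (n : ι → ι → ι → ℤ), ∀ i j k, (𝒰.U i ∩ 𝒰.U j ∩ 𝒰.U k).Nonempty →
        c i j k - (a i j + a j k - a i k) = n i j k)
    (E : Type) [NormedAddCommGroup E] [NormedSpace ℂ E] [FiniteDimensional ℂ E] :
    ((integrationDeRhamIsoFamily E).complexify).IsLefschetzOneOne := by
  intro n X hX M _ _ _ _ _ _ φA hφA β hβi hβ11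
  haveI : CompactSpace M := by
    haveI := compactSpace_complexPoints_of_isSmoothProjective hX
    exact hφA.homeomorph.symm.compactSpace
  -- Step 1: a real closed `(1,1)` representative
  obtain ⟨θ, hθ, hθt, hθr, hβθ⟩ := exists_real_closed_oneOne_rep β hβi hβ11
  have hθs : IsSmoothForm θ := ((mem_cclosedSmoothForms_iff θ).1 hθ).1
  have hθc : IsClosedForm θ := ((mem_cclosedSmoothForms_iff θ).1 hθ).2
  -- a finite chart-convex cover
  obtain ⟨s, ⟨𝒰⟩⟩ := exists_chartConvexCover (E := E) (M := M)
  -- Steps 2–5, with (Z) for `θ` and `𝒰`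
  have hint : IsIntegralClass ((integrationDeRhamIsoFamily E).complexify M 2
      (complexDeRhamCohomology.mk E M 2 ⟨θ, hθ⟩)) := hβθ ▸ hβi
  obtain ⟨L, h, -, hChern⟩ := exists_isChernForm_of_cechIntegral 𝒰 hθs hθc hθt hθr
    (hZ E M (↥s) 𝒰 θ hθ hint)
  exact ⟨↥s, L, h, θ, hθs, hθc, hChern, hβθ⟩

/-- **`lefschetzOneOne_rational` from Čech integrality (Z) and the meromorphic-section lemma of
Cor. 11.34 alone.** The tree's reduction `lefschetzOneOne_rational_of_rigidity_of_isTrivialOn` fed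
with the discharged rigidity (`NaturalDeRhamComparisonRigidity_holds`), the natural family
`(integrationDeRhamIsoFamily E) ⊗ ℂ` (`integrationDeRhamIsoFamily_isNatural`,
`DeRhamIsoFamily.complexify_isNatural`) and the heart just proved from (Z). Voisin I, §11.3.2:
"The case `k = 1` of this conjecture holds by theorem 11.30 and corollary 11.34."
[cite: VoisinHodgeI2002, §11.3.2 (remark after Conj. 11.36), Thm. 11.30 and Cor. 11.34 (proof)] -/
theorem lefschetzOneOne_rational_of_cechIntegral_of_isTrivialOn
    (hZ : ∀ (E : Type) [NormedAddCommGroup E] [NormedSpace ℂ E] [FiniteDimensional ℝ E]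
      (M : Type) [TopologicalSpace M] [ChartedSpace E M] [IsManifold 𝓘(ℝ, E) ∞ M] [T2Space M]
      [CompactSpace M] (ι : Type) [Fintype ι] (𝒰 : ChartConvexCover E M ι)
      (θ : MForm 𝓘(ℝ, E) M ℂ 2) (hθ : θ ∈ cclosedSmoothForms E M 2),
      IsIntegralClass ((integrationDeRhamIsoFamily E).complexify M 2
        (complexDeRhamCohomology.mk E M 2 ⟨θ, hθ⟩)) →
      ∀ (α : ι → MForm 𝓘(ℝ, E) M ℂ 1), (∀ i, α i ∈ smoothFormsOn 𝓘(ℝ, E) ℂ (𝒰.U i) 1) →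
        (∀ i, ∀ x ∈ 𝒰.U i, mextDeriv (α i) x = θ x) →
      ∀ (f : ι → ι → M → ℂ),
        (∀ i j, ∀ x ∈ 𝒰.U i ∩ 𝒰.U j, (MForm.ofFun 𝓘(ℝ, E) (f i j)).SmoothAt x) →
        (∀ i j, ∀ x ∈ 𝒰.U i ∩ 𝒰.U j,
          mextDeriv (MForm.ofFun 𝓘(ℝ, E) (f i j)) x = α i x - α j x) →
      ∀ (c : ι → ι → ι → ℂ),
        (∀ i j k, ∀ x ∈ 𝒰.U i ∩ 𝒰.U j ∩ 𝒰.U k, f i j x + f j k x - f i k x = c i j k) →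
      ∃ (a : ι → ι → ℂ) (n : ι → ι → ι → ℤ), ∀ i j k, (𝒰.U i ∩ 𝒰.U j ∩ 𝒰.U k).Nonempty →
        c i j k - (a i j + a j k - a i k) = n i j k)
    (h₂ : ∀ ⦃n : ℕ⦄ ⦃X : Motives.SchemeOver ℂ⦄, Motives.IsSmoothProjective n X → ∀ (A : HodgeModel n X)
      (ι : Type) (L : HolomorphicLineBundle ι A.model A.carrier),
      ∃ S : Set A.carrier, IsAnalyticSet 𝓘(ℂ, A.model) S ∧ S ≠ Set.univ ∧ L.IsTrivialOn Sᶜ) :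
    lefschetzOneOne_rational :=
  lefschetzOneOne_rational_of_rigidity_of_isTrivialOn NaturalDeRhamComparisonRigidity_holds
    (fun E _ _ _ ↦ ⟨(integrationDeRhamIsoFamily E).complexify,
      DeRhamIsoFamily.complexify_isNatural (integrationDeRhamIsoFamily_isNatural (E := E)),
      isLefschetzOneOne_complexify_integration_of_cechIntegral hZ E⟩)
    h₂

end Heart

end Literature.AlgebraicGeometry.HodgeTheory

end
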